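import Literature.MathematicalPhysics.QuantumFieldTheory.Balaban1983to89.B9Cor36GpCubeLocAtMember
import Literature.MathematicalPhysics.QuantumFieldTheory.Balaban1983to89.B9Thm37GpAtCoverLarge

/-!
# `Balaban1983to89.B9Cor36GpCoverBinders` — THE G′-JUNCTION OF [B9] THEOREM 3.7 OVER THE WHOLE CUBE COVER OF ONE MEMBER: Corollary 3.6's per-cube tuple
# `(IsUnit Δ′_{a,□}(Ṽ_□), hloc, hlocT, hE)` for the site-sector cube letter of record packaged as the `∀ □` binders of p21's M5.5 FILE 7
# `B9Thm37GpAtCoverLarge.eBlock_Gp_large` at per-cube (3.35) data `(u_□, A_□, Q_□, C_□, ξ_□, Λ_□)`, and THAT THEOREM APPLIED: Theorem 3.7 ⇒ Theorem 3.1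
# (3.42)₁₋₄ for `G′(U)` at a (3.35)-regular `U`, for every member above one threshold, from the cube data — M5.6's `hE` ∕ `hEc` pair at one constant and rate
# (sub-row G-B9-LETTERS, module M5.1b-G′, FILE 8 = the member-level close of seat p33's module; twin of p21's E2-6 `B9Cor36CinvCoverBinders` on the C-side)

T. Bałaban, *Propagators for lattice gauge theories in a background field*, Commun. Math. Phys. **99** (1985) 389–434
[`Balaban1985BackgroundPropagators`, "B9"]; [4] = T. Bałaban, *Propagators and renormalization transformations for lattice gauge
theories. II*, Commun. Math. Phys. **96** (1984) 223–250 [`Balaban1984PropagatorsII`].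

statement-level skeleton of published theorems with citation tags; proofs where landed; nothing here is a claim about the
Yang–Mills mass gap

THE PRINTED LOCUS (verbatim, held `paper:balaban1985-cmp99-background-propagators`, journal page = PDF page + 388).  Cor. 3.6 p. 408 l. 1–10 (*«U … regular on
each cube □̃ from the cover π′_j … the operators G_□(U), G′_□(U) defined by the sequence {Ω_n(□)} satisfy (3.42)–(3.47)»*); p. 408 l. 20–25 (*«for each cube □ from 𝒟_j …
there exists a gauge transformation u defined on □̃⁵»* — the datum is PER CUBE); (3.87)–(3.90) p. 409 (`G′₀ = Σ_□ h_□G′_□h_□`, `Δ′_aG′₀ = I − R′`, `G′ = G′₀(I − R′)⁻¹`);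
Thm 3.7 pp. 409–410 (statement p. 409, proof sentence p. 410 l. 2) (*«This theorem follows simply from Corollary 3.6 holding for all G′_□, □ ∈ 𝒟, from the bound (3.89) and Lemma 2.1»*, *«Theorem 3.7 implies that all
the inequalities (3.42)–(3.47) hold for G′, thus we have completed the proof of Theorem 3.1»*, *«For M sufficiently large»*); Thm 3.1 (3.42) p. 397.

WHY THIS FILE.  p21's M5.5 FILE 7 `eBlock_Gp_large` (Theorem 3.7 ⇒ (3.42)₁₋₄ for `G′(U)`, member-independent constant, no located smallness) consumes, per member,
the cube letters `Oc : cubes → SiteOpY` with THREE per-cube binders — the two local-inverse laws `hloc`, `hlocT` at the cut-off of record `h_□` and the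
Corollary-3.6 block `hE : EBlock (kernelFamilySInv i B cfg (Oc □) parS) B₀ δ₀ U₁` — besides `G′Δ′_a = 1`, bi-contractive bond variables ∕ averaging transporters,
the section `ιB` and the neighbourhoods `Tn`.  Seat p33's module M5.1b-G′ delivered these per cube for the U-constant site-sector cube letter of design (R),
`O_□ := locLetterY i □ parSymY u_□ χ_□ Ṽ_□ = χ_□R(u_□)⁻¹G′_□(Ṽ_□)R(u_□)χ_□` (`Ṽ_□ = locCfgY i □ η A_□`), from ONE cover cube's (3.35) datum: FILE 7b-D2
`B9Cor36GpCubeLocAtMember.eBlock_locLetterY` (`IsUnit Δ′_{a,□}(Ṽ_□)` ∧ `hE`, thresholds and `a₁` uniform in member and cube) and FILE 4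
`B9Cor36CubeCutoffs.localInverse_laws_hTY_parSymY` (`hloc`, `hlocT` from that unit).  Print's datum is per cube (its own gauge `u_□` and potential `A_□` on
`□̃⁵`), so the consumer's binders are fed by a FAMILY of per-cube data — exactly as p21's E2-6 does on the C-side.  THIS FILE is that bookkeeping AND the
application: §1 ★★ `gpLoc_cover_binders` — the four `∀ □` binders at per-cube data functions; §2 ★★★ `eBlock_Gp_of_cubeData` — `eBlock_Gp_large` applied at
`parS := parSymY`, `α := 1/4`: for every member above ONE threshold, from the data family, a letter `Gp` with `Gp U·Δ′_a(U; parSymY) = 1`, bi-contractive bond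
variables ∕ transporters, `ιB`, `Tn`: `EBlock (kernelFamilySInv i B cfg Gp parSymY) K_G δ_G U₁` AND `∀ □, EBlock (kernelFamilySInv i B cfg (Oc □) parSymY) K_G δ_G U₁`
with ONE `(K_G, δ_G)`, `δ_G = δ∕2 > 0` (`eBlock_mono'`) — the `hE` ∕ `hEc` pair of p21's M5.6 end statement `B9Thm39CinvAtCoverLargeDefect.cinv_cover_large_defect`.

HONEST SCOPE / NOT CLAIMED.  Pure packaging ∕ composition of landed theorems (no estimate added).  DISPLAYED (as in 7b-D2 ∕ E2-6 ∕ M5.5 FILE 7): per-cube data in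
p33's `gp_cube_at_locCfg` form (`Q_□ ⊇ NearC_□(35S_j∕8 + 1)` inside print's `□̃⁵` — FILE 4's open question (Q1), which class cube supplies it, is not decided
here), bi-contractive gauges, the member thresholds (existential; «For M sufficiently large»), the (3.37) smallness `α₁(□) ≤ min(a₁, 1∕4)`, `etaS i = η`, and in §2
`Gp U·Δ′_a(U) = 1` (Thm 3.11 ∕ M5.3; at the matrix fibre def-Y's `Node00.GpY_mul_deltaPrimeAY`), bi-contractive bond variables and averaging transporters,
the section `ιB`, the neighbourhoods `Tn` with their count `m_N`, `[NormOneClass 𝔸]`, a real basis `b` with `|b.repr v j| ≤ M₂‖v‖`.  The rate is `δ∕2` with 7b-D2's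
`δ` (print: «a decay rate arbitrarily close»; no optimisation attempted); the constant is `max K_G B₀`, explicit but unoptimised.  NOT supplied: M5.6's `hD` (cell
GAPS G-B9-05), `IsUnit XY`, `hpar`, the bond-sector letter `G_□` (M5.1b-G, p38 lineage), and the final instantiation of `cinv_cover_large_defect` (the
assembler's).  Sup-entries (3.42)₁₋₄ only; finite 𝕋 members of the k-level V1 family; count-neutral; no summit ∕ sub-problem statement is proved; nothing
continuum ∕ OS ∕ mass-gap ∕ Clay; NOT a node discharge.  No `sorry`, no `axiom`, no `… : Prop` fact, no `instance`, no `notation`, no `def`.  NEW file;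
nothing landed is modified.  Cell `lit-balaban`, seat `lit-balaban-p33` gen 98, 2026-08-28; `--supports stmt-QuantumFields-19200` as helper.  Net new unproved facts: 0.

RELATED IN THE TREE, NOT DUPLICATED (searched 2026-08-28: `lean search 'GpCoverBinders|gpLoc_cover_binders|eBlock_Gp_of_cubeData' --decl` = ∅): FILE 7b-D2
`B9Cor36GpCubeLocAtMember`, FILE 4 `B9Cor36CubeCutoffs`, FILE 7a `B9Cor36GpCubeIsUnit` (the same two laws from Thm 3.4's route — not used here: 7b-D2's unit
gives one threshold set), p21's M5.5 FILES 6∕7 `B9Thm37GpTorusRegularFinal` ∕ `B9Thm37GpAtCoverLarge` (USED BY NAME), p21's E2-6 `B9Cor36CinvCoverBinders`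
(the C-side twin; its binder list copied, not imported).
-/

noncomputable section

namespace Literature.MathematicalPhysics.QuantumFieldTheory.Balaban1983to89.B9Cor36GpCoverBinders

open B4PartitionUnity22 (thetaProf D1)
open B9Eq39Adjoint (fluct covD)
open B6KLevelCensusIndexV1 (KIdx kGeo)
open B6Cover236MultiLevelBlocks (cubes)
open B6GlobalChartV1 (PV boxEquiv)
open B6Ineq2142KLevelV1 (β)
open B9BackgroundsKLevelV1 (shiftsV1)
open B9Eq360DeltaPrimeAY (AfldY)
open B9CubeGeometryInputs (RM1)
open B9GeoNormsKLevelV1 (geo9K)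
open B9FromB6 (EBlock)
open B9CubeLettersOpsL0 (deltaPrimeACubeY)
open B9CubeLettersInvReadings (kernelFamilySInv)
open B9Cor36CubeCutoffs (SC NearC chiY locCfgY localInverse_laws_hTY_parSymY)
open B9Cor36GpCubeLocLetter (locLetterY)
open B9Cor36GpCubeLocAtMember (eBlock_locLetterY)
open B9Thm37CubeCoverCommutators (cutMulY hTY)
open B9Thm37GpAtCoverLarge (eBlock_Gp_large eBlock_mono' geo9K_M_eq')
open Node00 (SiteY BlkY CfgY GaugeY IBondY SiteOpY toKT gaugeY parSymY deltaPrimeAY UboxY avgTrY etaS)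

variable {d ℓ : ℕ} {hd : 1 ≤ d + 1} {hL : Odd (ℓ + 1) ∧ 1 < ℓ + 1} {b₀ b₁ : ℝ}
variable {𝔸 : Type} [NormedRing 𝔸] [NormedAlgebra ℂ 𝔸] [CompleteSpace 𝔸] [NormOneClass 𝔸]
variable {ι : Type} [Fintype ι] [DecidableEq ι] (b : Module.Basis ι ℝ 𝔸)
variable [∀ i' : KIdx d ℓ hd hL b₀ b₁, Fintype (geo9K i').Site]

/-! ## §1 ★★ The four `∀ □` binders of M5.5 FILE 7 for the cube letters of record, from per-cube (3.35) data -/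

/-- ★★ **M5.5's `∀ □` BINDERS `IsUnit Δ′_{a,□}(Ṽ_□)`, `hloc`, `hlocT`, `hE` FOR THE SITE-SECTOR CUBE LETTERS OF RECORD, FROM PER-CUBE (3.35) DATA** (FILE 7b-D2 + FILE 4 cube by
cube; quantifier bookkeeping only): there are a rate `δ > 0`, a constant `B₀ ≥ 0`, thresholds `M₀, T₀, N₀` and `a₁ > 0` — 7b-D2's, functions of `d, L, M₂, b` only — such that for
every member above the thresholds, every section `ιB`, field `U` and every family of per-cube data — a bi-contractive gauge `u_□`, a potential `A_□` on a torus set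
`Q_□ ⊇ NearC_□(35S_j∕8 + 1)` with `U^{u_□} = e^{iηA_□}` on its bonds, `‖A_□‖ ≦ C_□ξ_□⁻¹`, `‖η⁻¹∂A_□‖ ≦ C_□ξ_□⁻²`, `0 < ξ_□ ≦ 5S_jη`, `L^{j+1}η ≦ Λ_□ξ_□`, `1 ≦ Λ_□`,
`max C_□ (C_□(1+D₁θ))Λ_□² ≦ min(a₁, 1∕4)` — and every background family through `U` (`etaS i = η`): for `O_□ := fun _ => locLetterY i □ parSymY (u □) χ_□ (locCfgY i □ η (A □))`,
ALL cubes at once satisfy `IsUnit (deltaPrimeACubeY i □ parSymY Ṽ_□)`, the two local-inverse laws at `hTY i □` against `deltaPrimeAY i parSymY U`, and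
`EBlock (kernelFamilySInv i B cfg O_□ parSymY) B₀ δ U₁`.
[cite: Balaban1985BackgroundPropagators, Cor. 3.6 p.408 l.1–10 + l.20–25, (3.87)–(3.88) p.409, Thm 3.7 pp.409–410, Thm 3.1 (3.42) p.397; Balaban1984PropagatorsII, (2.52)–(2.55) p.232] -/
theorem gpLoc_cover_binders (hℓ : 1 ≤ ℓ) {M₂ : ℝ} (hM₂ : 0 ≤ M₂) (hrepr : ∀ (v : 𝔸) (j : ι), |b.repr v j| ≤ M₂ * ‖v‖) :
    ∃ δ B₀ M₀ T₀ : ℝ, ∃ N₀ : ℕ, 0 < δ ∧ 0 ≤ B₀ ∧ ∃ a₁ : ℝ, 0 < a₁ ∧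
    ∀ (i : KIdx d ℓ hd hL b₀ b₁) (Rr : ℝ) (Hp : Prop),
      M₀ ≤ ((ℓ : ℝ) + 1) * (toKT i).Mh → N₀ + 1 ≤ (toKT i).R * ((ℓ + 1) * (toKT i).Mh) → T₀ ≤ RM1 i →
    ∀ (ιB : BlkY i → IBondY i), (∀ s, β i.hN i.D i.hk (ιB s) = s) →
    ∀ (U : CfgY 𝔸 i) (g : ↥(cubes (toKT i).D.toDomains) → GaugeY 𝔸 i),
      (∀ c x, ‖(g c x : 𝔸)‖ ≤ 1 ∧ ‖(((g c x)⁻¹ : 𝔸ˣ) : 𝔸)‖ ≤ 1) →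
    ∀ (A : ↥(cubes (toKT i).D.toDomains) → AfldY 𝔸 i) (Q : ↥(cubes (toKT i).D.toDomains) → Set (Site (PV d ℓ i.m i.K hd hL) 0))
      (C ξ Λ : ↥(cubes (toKT i).D.toDomains) → ℝ),
      (∀ c, 0 ≤ C c) → (∀ c, 0 < ξ c) → (∀ c, 1 ≤ Λ c) → (∀ c, ξ c ≤ 5 * (SC i c : ℝ) * (kGeo i).eta) →
      (∀ c, LatticeNorms.scaleLen ((ℓ : ℝ) + 1) (kGeo i).eta (c.1.1 + 1) ≤ Λ c * ξ c) →
      (∀ c, ∀ x : Site (PV d ℓ i.m i.K hd hL) 0, NearC i c (35 * SC i c / 8 + 1) (boxEquiv i.hN x).1 → x ∈ Q c) →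
      (∀ c, ∀ (κ : Fin (d + 1)) (x : Site (PV d ℓ i.m i.K hd hL) 0), x ∈ Q c → x.shift κ ∈ Q c → gaugeY i (g c) U κ x = fluct (kGeo i).eta (A c) κ x) →
      (∀ c, ∀ κ, ∀ x ∈ Q c, ‖A c κ x‖ ≤ C c * (ξ c)⁻¹) →
      (∀ c, ∀ μ ν, ∀ x ∈ Q c, ‖(((kGeo i).eta : ℂ)⁻¹) • covD (shiftsV1 (PV d ℓ i.m i.K hd hL)) (fun _ _ => (1 : 𝔸ˣ)) μ (A c ν) x‖ ≤ C c * (ξ c ^ 2)⁻¹) →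
      (∀ c, max (C c) (C c * (1 + D1 thetaProf)) * Λ c ^ 2 ≤ a₁) → (∀ c, max (C c) (C c * (1 + D1 thetaProf)) * Λ c ^ 2 ≤ 1 / 4) →
    ∀ {B : B9.Backgrounds} (cfg : B.Cfg → CfgY 𝔸 i) (U₁ : B.Cfg), cfg U₁ = U → etaS i = (kGeo i).eta →
      (∀ c : ↥(cubes (toKT i).D.toDomains), IsUnit (deltaPrimeACubeY i c (parSymY i) (locCfgY i c (kGeo i).eta (A c)))) ∧
      (∀ c : ↥(cubes (toKT i).D.toDomains),
        cutMulY (hTY i c) * deltaPrimeAY i (parSymY i) U * locLetterY i c (parSymY i) (g c) (chiY i c) (locCfgY i c (kGeo i).eta (A c)) *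
            cutMulY (hTY i c) = cutMulY (hTY i c) * cutMulY (hTY i c)) ∧
      (∀ c : ↥(cubes (toKT i).D.toDomains),
        cutMulY (hTY i c) * locLetterY i c (parSymY i) (g c) (chiY i c) (locCfgY i c (kGeo i).eta (A c)) * deltaPrimeAY i (parSymY i) U *
            cutMulY (hTY i c) = cutMulY (hTY i c) * cutMulY (hTY i c)) ∧
      (∀ c : ↥(cubes (toKT i).D.toDomains),
        EBlock (kernelFamilySInv i B cfg (fun _ => locLetterY i c (parSymY i) (g c) (chiY i c) (locCfgY i c (kGeo i).eta (A c))) (parSymY i)) B₀ δ U₁) := by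
  obtain ⟨δ, B₀, M₀, T₀, N₀, hδ, hB₀, a₁, ha₁, H⟩ := eBlock_locLetterY b d ℓ hℓ M₂ hM₂ hrepr
  refine ⟨δ, B₀, M₀, T₀, N₀, hδ, hB₀, a₁, ha₁, ?_⟩
  intro i Rr Hp hM hN hT ιB hι U g hu A Q C ξ Λ hC0 hξ hΛ hξS hΛξ hQ hgA hA hdA hα₁ hα4 B cfg U₁ hcfg hη
  have key := fun c : ↥(cubes (toKT i).D.toDomains) =>
    H i c hM hN hT (g c) U (A c) (Q c) (C c) (ξ c) (Λ c) (hC0 c) (hξ c) (hΛ c) (hξS c) (hΛξ c) (hQ c) (hgA c) (hA c) (hdA c) (hα₁ c) (hα4 c) (hu c)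
      ιB hι Rr Hp cfg (parSymY i) U₁ hcfg hη
  -- the datum set contains the smaller neighbourhood FILE 4 asks for (`3S_j + 2 ≤ 35S_j/8 + 1` since `S_j ≥ 1`… in fact `≥ 9`)
  have hQ' : ∀ (c : ↥(cubes (toKT i).D.toDomains)) (x : Site (PV d ℓ i.m i.K hd hL) 0),
      NearC i c (3 * SC i c + 2) (boxEquiv i.hN x).1 → x ∈ Q c := fun c x hx =>
    hQ c x (hx.mono i c (by have := B9Cor36CubeCutoffs.one_le_SC i c; omega))
  have laws := fun c : ↥(cubes (toKT i).D.toDomains) =>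
    localInverse_laws_hTY_parSymY i c (g c) U (kGeo i).eta (A c) (hQ' c) (hgA c) (key c).1
  exact ⟨fun c => (key c).1, fun c => (laws c).1, fun c => (laws c).2, fun c => (key c).2⟩

/-! ## §2 ★★★ Theorem 3.7 ⇒ Theorem 3.1 (3.42)₁₋₄ for `G′(U)` at a (3.35)-regular `U`, from the cube data: M5.6's `hE` ∕ `hEc` pair -/

/-- ★★★ **THEOREM 3.7 ⇒ THEOREM 3.1 (3.42)₁₋₄ FOR `G′(U)` AT A (3.35)-REGULAR BACKGROUND, FOR EVERY MEMBER ABOVE ONE THRESHOLD, FROM COROLLARY 3.6's CUBE DATA** (p21's M5.5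
FILE 7 `eBlock_Gp_large` at `parS := parSymY`, `α := 1∕4`, its four `∀ □` binders fed by §1; the cube letters' own blocks weakened to the common constant and rate by
`eBlock_mono'`): for a neighbour count `m_N` and the basis datum there are `δ_G > 0`, `K_G ≥ 0`, thresholds `M₀, T₀, N₀` and `a₁ > 0` such that for every member above the
thresholds, every section `ιB`, field `U`, family of per-cube (3.35) data as in §1, background family through `U` (`etaS i = η`), every letter `Gp` with
`Gp U·Δ′_a(U; parSymY) = 1` (Thm 3.11: `G′(U) = Δ′_a(U)⁻¹`), bi-contractive bond variables of `U` and averaging transporters, and neighbourhoods `Tn` of at most `m_N`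
index bonds containing the unit balls: `EBlock (kernelFamilySInv i B cfg Gp parSymY) K_G δ_G U₁` — the four (3.42) entries of `η²G′(U)` over the invariant class —
AND `∀ □, EBlock (kernelFamilySInv i B cfg O_□ parSymY) K_G δ_G U₁` for the cube letters `O_□` of §1 (M5.6's `hE`, `hEc` at one `(K_G, δ_G)`).
[cite: Balaban1985BackgroundPropagators, Thm 3.7 (3.87)–(3.90) pp.409–410 («follows simply from Corollary 3.6 holding for all G′_□ … and Lemma 2.1», «implies that all the inequalities (3.42)–(3.47) hold for G′»), Thm 3.1 (3.42) p.397, Cor. 3.6 p.408; Balaban1984PropagatorsII, Prop 2.2 (2.65)–(2.67), Lemma 2.1 (2.59)–(2.63) pp.233–234] -/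
theorem eBlock_Gp_of_cubeData [∀ i' : KIdx d ℓ hd hL b₀ b₁, DecidableEq (geo9K i').Site]
    (Rr : KIdx d ℓ hd hL b₀ b₁ → ℝ) (Hp : KIdx d ℓ hd hL b₀ b₁ → Prop)
    (hℓ : 1 ≤ ℓ) {M₂ : ℝ} (hM₂ : 0 ≤ M₂) (hrepr : ∀ (v : 𝔸) (j : ι), |b.repr v j| ≤ M₂ * ‖v‖) (mN : ℕ) :
    ∃ δG KG M₀ T₀ : ℝ, ∃ N₀ : ℕ, 0 < δG ∧ 0 ≤ KG ∧ ∃ a₁ : ℝ, 0 < a₁ ∧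
    ∀ (i : KIdx d ℓ hd hL b₀ b₁),
      M₀ ≤ ((ℓ : ℝ) + 1) * (toKT i).Mh → N₀ + 1 ≤ (toKT i).R * ((ℓ + 1) * (toKT i).Mh) → T₀ ≤ RM1 i →
    ∀ (ιB : BlkY i → IBondY i), (∀ s, β i.hN i.D i.hk (ιB s) = s) →
    ∀ (U : CfgY 𝔸 i) (g : ↥(cubes (toKT i).D.toDomains) → GaugeY 𝔸 i),
      (∀ c x, ‖(g c x : 𝔸)‖ ≤ 1 ∧ ‖(((g c x)⁻¹ : 𝔸ˣ) : 𝔸)‖ ≤ 1) →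
    ∀ (A : ↥(cubes (toKT i).D.toDomains) → AfldY 𝔸 i) (Q : ↥(cubes (toKT i).D.toDomains) → Set (Site (PV d ℓ i.m i.K hd hL) 0))
      (C ξ Λ : ↥(cubes (toKT i).D.toDomains) → ℝ),
      (∀ c, 0 ≤ C c) → (∀ c, 0 < ξ c) → (∀ c, 1 ≤ Λ c) → (∀ c, ξ c ≤ 5 * (SC i c : ℝ) * (kGeo i).eta) →
      (∀ c, LatticeNorms.scaleLen ((ℓ : ℝ) + 1) (kGeo i).eta (c.1.1 + 1) ≤ Λ c * ξ c) →
      (∀ c, ∀ x : Site (PV d ℓ i.m i.K hd hL) 0, NearC i c (35 * SC i c / 8 + 1) (boxEquiv i.hN x).1 → x ∈ Q c) →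
      (∀ c, ∀ (κ : Fin (d + 1)) (x : Site (PV d ℓ i.m i.K hd hL) 0), x ∈ Q c → x.shift κ ∈ Q c → gaugeY i (g c) U κ x = fluct (kGeo i).eta (A c) κ x) →
      (∀ c, ∀ κ, ∀ x ∈ Q c, ‖A c κ x‖ ≤ C c * (ξ c)⁻¹) →
      (∀ c, ∀ μ ν, ∀ x ∈ Q c, ‖(((kGeo i).eta : ℂ)⁻¹) • covD (shiftsV1 (PV d ℓ i.m i.K hd hL)) (fun _ _ => (1 : 𝔸ˣ)) μ (A c ν) x‖ ≤ C c * (ξ c ^ 2)⁻¹) →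
      (∀ c, max (C c) (C c * (1 + D1 thetaProf)) * Λ c ^ 2 ≤ a₁) → (∀ c, max (C c) (C c * (1 + D1 thetaProf)) * Λ c ^ 2 ≤ 1 / 4) →
    ∀ {B : B9.Backgrounds} (cfg : B.Cfg → CfgY 𝔸 i) (U₁ : B.Cfg), cfg U₁ = U → etaS i = (kGeo i).eta →
    ∀ (Gp : SiteOpY 𝔸 i), Gp U * deltaPrimeAY i (parSymY i) U = 1 →
      (∀ (μ : Fin (d + 1)) (x : SiteY i), ‖(UboxY i U μ x : 𝔸)‖ ≤ 1 ∧ ‖(((UboxY i U μ x)⁻¹ : 𝔸ˣ) : 𝔸)‖ ≤ 1) →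
      (∀ z w : SiteY i, ‖(avgTrY i (parSymY i) U z w : 𝔸)‖ ≤ 1 ∧ ‖(((avgTrY i (parSymY i) U z w)⁻¹ : 𝔸ˣ) : 𝔸)‖ ≤ 1) →
    ∀ (Tn : IBondY i → Finset (IBondY i)), (∀ a y' : IBondY i, (geo9K i).dist a y' ≤ 1 → a ∈ Tn y') → (∀ y' : IBondY i, (Tn y').card ≤ mN) →
      EBlock (kernelFamilySInv i B cfg Gp (parSymY i)) KG δG U₁ ∧
      ∀ c : ↥(cubes (toKT i).D.toDomains),
        EBlock (kernelFamilySInv i B cfg (fun _ => locLetterY i c (parSymY i) (g c) (chiY i c) (locCfgY i c (kGeo i).eta (A c))) (parSymY i)) KG δG U₁ := by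
  -- §1: the per-cube binders with 7b-D2's `(δ, B₀)` and thresholds
  obtain ⟨δ, B₀, M₀, T₀, N₀, hδ, hB₀, a₁, ha₁, H⟩ := gpLoc_cover_binders b (hd := hd) (hL := hL) (b₀ := b₀) (b₁ := b₁) hℓ hM₂ hrepr
  -- M5.5 FILE 7 at `(B₀, δ, α := 1/4)`: one more member threshold `ML` and the constant `K_G`
  have hαδ : 0 < (1 / 4 : ℝ) * δ := by positivity
  have hαδ2 : 0 ≤ (1 - 2 * (1 / 4 : ℝ)) * δ := by nlinarith
  obtain ⟨ML, KG, hKG, HG⟩ := eBlock_Gp_large (𝔸 := 𝔸) Rr Hp b hM₂ hrepr hB₀ hδ.le hαδ hαδ2 mN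
  have hKG' : 0 ≤ max KG B₀ := le_max_of_le_left hKG
  have hδG : (1 - 2 * (1 / 4 : ℝ)) * δ ≤ δ := by nlinarith
  refine ⟨(1 - 2 * (1 / 4 : ℝ)) * δ, max KG B₀, max M₀ ML, T₀, N₀, by positivity, hKG', a₁, ha₁, ?_⟩
  intro i hM hN hT ιB hι U g hu A Q C ξ Λ hC0 hξ hΛ hξS hΛξ hQ hgA hA hdA hα₁ hα4 B cfg U₁ hcfg hη Gp hinvC hVb hTr Tn hTn hnbr
  have hM₀ : M₀ ≤ ((ℓ : ℝ) + 1) * (toKT i).Mh := (le_max_left _ _).trans hM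
  have hML : ML ≤ (geo9K i).M := by
    rw [geo9K_M_eq' i]; exact (le_max_right _ _).trans hM
  obtain ⟨hunit, hloc, hlocT, hE⟩ :=
    H i (Rr i) (Hp i) hM₀ hN hT ιB hι U g hu A Q C ξ Λ hC0 hξ hΛ hξS hΛξ hQ hgA hA hdA hα₁ hα4 cfg U₁ hcfg hη
  subst hcfg
  have hη' : etaS i = |i.cf|⁻¹ := hη
  have main := HG i hML cfg (parSymY i) (U₁ := U₁) ιB hι hη' Gp
    (fun c _ => locLetterY i c (parSymY i) (g c) (chiY i c) (locCfgY i c (kGeo i).eta (A c))) hinvC hloc hlocT hE hVb hTr Tn hTn hnbr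
  exact ⟨eBlock_mono' i _ (le_max_left _ _) le_rfl hKG' main,
    fun c => eBlock_mono' i _ (le_max_right _ _) hδG hKG' (hE c)⟩

end Literature.MathematicalPhysics.QuantumFieldTheory.Balaban1983to89.B9Cor36GpCoverBinders

end
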